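import Literature.Analysis.FluidPDE.NSCriticalClosureBesovLeaves
import Literature.Analysis.FluidPDE.KNSSLocalSmoothingHolds
import HarnessLib

/-!
# The critical Besov continuation criterion rests on a single named fact

Analysis/FluidPDE assembly file (proofs only: no definitions, no named facts, no statement of the
tree is changed) for the named fact
`Literature.Analysis.FluidPDE.hasSmoothExtensionPast_of_eHomBesovNorm_bounded`
(`NSCriticalClosure.lean`; Gallagher–Koch–Planchon 2016, Thm. 1, in contrapositive form for
classical Leray–Hopf solutions from rapidly decaying data: a bounded critical Besov norm
`Ḃ^{-1+3/r}_{r,q}`, `3 < r, q < ∞`, on `[0, T)` gives a smooth extension past `T`).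

State before this file. `NSCriticalClosureBesovLeaves.lean` records the fact as the implication
from the two named facts `gkp_besov_blowup` (GKP 2016, Thm. 1) and (L)
`knss2009_local_smoothing ℝ³` (Koch–Nadirashvili–Seregin–Šverák 2009, Prop. 4.1, quantitative
short-time form), Tao's smooth local theory having been discharged; GKP's Thm. 1 in turn
follows from Albritton's Thm. 1.1 (`albritton_besov_blowup`, via `gkp_besov_blowup_of_albritton`,
`CriticalRegularityProofs.lean`). Meanwhile **(L) has been discharged**:
`knss2009_local_smoothing_holds` (`KNSSLocalSmoothingHolds.lean`, the weighted Picard iteration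
of KNSS §4).

What this file records. Feeding that discharge in, the whole local/smoothing side of the chain is
a theorem of the tree, and the continuation criterion rests on **one** named fact of the
blow-up-criterion type — either of

* `hasSmoothExtensionPast_of_eHomBesovNorm_bounded_of_gkpThm1 : gkp_besov_blowup → _`
  (GKP 2016, Thm. 1);
* `hasSmoothExtensionPast_of_eHomBesovNorm_bounded_of_albritton : albritton_besov_blowup → _`
  (Albritton 2018, Thm. 1.1).

(Earlier versions also recorded two finer variants. One from the "two halves" of Albritton's
Thm. 1.1, `albritton_singular_point_of_blowup` = Cor. 4.6 and `albritton_regular_of_liminf_besov` =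
§3, Steps 1–3 of its proof; the latter named fact was retired on review (D-0026: a slice of the
parent's proof, and a corollary of `albritton_besov_blowup` itself). One from GKP's
Propositions 2.1–2.3 in the exponent classes `p = q = 3·2^k - 2` (`…_of_gkpProps3`, through
`limsup_eq_top_of_isGKPExponent`, GKP 2016, §2.1); the tree-class rendering `gkp_rigidity` of
Prop. 2.3 was likewise merged back into the proof obligation of Thm. 1 on review (2026-08-15,
D-0026: mis-stated over the tree's class, Step 3 of the printed proof by contradiction, and a
corollary of `gkp_besov_blowup` itself, `gkp_rigidity_of_gkp_besov_blowup`), so Prop. 2.3 is no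
longer a named fact of the tree and a record through it is no longer a record on named facts. Both
records are dropped — they carried nothing beyond `…_of_albritton`, resp. `…_of_gkpThm1` composed
with `gkp_besov_blowup_of_gkp`.)

`#print axioms` of each is `propext, Classical.choice, Quot.sound`: everything else in the chain
(Tao 2013 Cor. 11.1, Cor. 4.3, Thm. 5.4; the Littlewood–Paley and Besov-embedding facts; KNSS
(A), (R), (C), (L), (P); the gluing of classical solutions) is proved. No chain avoiding a
blow-up criterion of GKP/Albritton type is known for a merely *bounded* (not continuous up to
`T`, not small) critical Besov norm: the `L³` criterion (Escauriaza–Seregin–Šverák 2003) does not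
apply since `Ḃ^{-1+3/r}_{r,q} ⊋ L³` for `r > 3`, and the bounded critical norm cannot be
interpolated with the (supercritical) energy class into a Ladyzhenskaya–Prodi–Serrin class.

## Mathlib / tree search

`lean search 'gkp_besov_blowup_holds|albritton_besov_blowup_holds' --decl`: absent (2026-08-15).
`knss2009_local_smoothing_holds`: `KNSSLocalSmoothingHolds.lean` (explicit space argument).
Mathlib: no Navier–Stokes theory.

## References

* I. Gallagher, G. S. Koch, F. Planchon, *Blow-up of critical Besov norms at a potential
  Navier–Stokes singularity*, Comm. Math. Phys. 343 (2016) 39–82 = arXiv:1407.4156, Thm. 1 (p. 5),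
  §2.1 (Props. 2.1–2.3). [GKP2016]
* D. Albritton, *Blow-up criteria for the Navier–Stokes equations in non-endpoint critical Besov
  spaces*, Anal. PDE 11 (2018) 1415–1456 = arXiv:1612.04439, Thm. 1.1, Cor. 4.6, §3.
  [Albritton2018]
* G. Koch, N. Nadirashvili, G. Seregin, V. Šverák, *Liouville theorems for the Navier–Stokes
  equations and applications*, Acta Math. 203 (2009) 83–105 = arXiv:0709.3599, Prop. 4.1.
  [KochNadirashviliSereginSverak2009]
-/

noncomputable section

namespace Literature.Analysis.FluidPDE

-- `linter.deprecated` is switched off for the next declaration only: it names the deprecated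
-- (mis-stated, 2026-08-15) tree-class rendering(s) of GKP Thm. 1 (`gkp_besov_blowup`,
-- `CriticalRegularity.lean`), kept unchanged for their users until the faithful path-space forms
-- are vendored (see those files).
set_option linter.deprecated false in
/-- **The critical Besov continuation criterion from GKP's Theorem 1 alone** (GKP 2016, Thm. 1,
contrapositive; the identification of the classical solution with a Besov mild solution through
Tao 2013 and the smoothing of bounded Besov mild extensions through KNSS 2009, Prop. 4.1, are
theorems of the tree): `hasSmoothExtensionPast_of_eHomBesovNorm_bounded_of_gkp_knssLocal` with
(L) supplied by its discharge `knss2009_local_smoothing_holds ℝ³`. [cite: GKP2016, Thm. 1] -/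
theorem hasSmoothExtensionPast_of_eHomBesovNorm_bounded_of_gkpThm1 (hG : gkp_besov_blowup) :
    hasSmoothExtensionPast_of_eHomBesovNorm_bounded :=
  hasSmoothExtensionPast_of_eHomBesovNorm_bounded_of_gkp_knssLocal hG
    (knss2009_local_smoothing_holds (EuclideanSpace ℝ (Fin 3)))

-- `linter.deprecated` is switched off for the next declaration only: it names the deprecated
-- (mis-stated, 2026-08-15) tree-class rendering(s) of Albritton Thm. 1.1 (`albritton_besov_blowup`,
-- `CriticalRegularity.lean`), kept unchanged for their users until the faithful path-space forms
-- are vendored (see those files).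
set_option linter.deprecated false in
/-- **The same from Albritton's Theorem 1.1 alone** (Albritton 2018, Thm. 1.1 ⟹ GKP Thm. 1,
`gkp_besov_blowup_of_albritton`, `CriticalRegularityProofs.lean`), through `…_of_gkpThm1`.
[cite: Albritton2018, Thm. 1.1] [cite: GKP2016, Thm. 1] -/
theorem hasSmoothExtensionPast_of_eHomBesovNorm_bounded_of_albritton
    (hAl : albritton_besov_blowup) : hasSmoothExtensionPast_of_eHomBesovNorm_bounded :=
  hasSmoothExtensionPast_of_eHomBesovNorm_bounded_of_gkpThm1 (gkp_besov_blowup_of_albritton hAl)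

-- `linter.deprecated` is switched off for the next declaration only: it names the deprecated
-- (mis-stated, 2026-08-15) tree-class rendering(s) of Albritton Thm. 1.1 (`albritton_besov_blowup`,
-- `CriticalRegularity.lean`); GKP Thm. 1 (`gkp_besov_blowup`, `CriticalRegularity.lean`), kept
-- unchanged for their users until the faithful path-space forms are vendored (see those files).
set_option linter.deprecated false in
/-- **The route's dependency record (2026-08-15): one leaf.** The continuation criterion holds as
soon as ANY of the blow-up criteria vendored as named facts of the tree is discharged — GKP Thm. 1
or Albritton's Thm. 1.1. [cite: GKP2016, Thm. 1] -/
theorem hasSmoothExtensionPast_of_eHomBesovNorm_bounded_of_any_blowup_criterion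
    (h : gkp_besov_blowup ∨ albritton_besov_blowup) :
    hasSmoothExtensionPast_of_eHomBesovNorm_bounded :=
  h.elim hasSmoothExtensionPast_of_eHomBesovNorm_bounded_of_gkpThm1
    hasSmoothExtensionPast_of_eHomBesovNorm_bounded_of_albritton

end Literature.Analysis.FluidPDE

end
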